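import Mathlib.MeasureTheory.Function.LocallyIntegrable
import Mathlib.MeasureTheory.Group.Integral
import Mathlib.MeasureTheory.Group.LIntegral
import Mathlib.Analysis.Calculus.ParametricIntegral
import Literature.NumberTheory.Automorphic.AutomorphicFormsL2WeightedTranslates
import HarnessLib

/-!
# Orbital smoothing in `L²` of the automorphic quotient: the integrated operator `∫ α(u) R(ι(u)) dν(u)` is
# represented by a left-invariant function on `G(𝔸_K)`, continuous and differentiable along the `ι`-orbits

Topic `NumberTheory/Automorphic`; sibling of `AutomorphicFormsL2DerivativeIntegral` and of
`AutomorphicFormsL2WeightedTranslates` (weighted Bochner integrals of translates over a parameter space, here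
specialised to a locally compact group `U` mapped into `G(𝔸_K)` by a continuous homomorphism `ι`).  Everything
is PROVED; no definition, no instance, no `sorry`.

Setting: `𝒢` an adelic group datum over a number field `K`, `μ` an automorphic measure on the quotient
`X = G(𝔸_K) ⧸ (A_G · G(K))` (`[𝒢.IsAutomorphicMeasure μ]`: finite, positive on opens, `G(𝔸_K)`-invariant;
the regular representation `R` on `L²(μ)`, `(R(g) f)(y) = f(g⁻¹ • y)` a.e., is strongly continuous,
`isStronglyContinuous_rightRegular_holds`), `φ = invQuot F : g ↦ F [g⁻¹]` the left-`A_G G(K)`-invariant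
function on the group attached to `F : X → ℂ` (D2 dictionary of `AutomorphicForms`).

* §0 (pure harmonic analysis on a locally compact second-countable Hausdorff group `U` with a measure `ν`):
  for `h` locally integrable and `α` continuous with compact support, the convolution
  `g ↦ ∫ α(g⁻¹ u) h(u) dν(u)` is continuous (`continuous_integral_mul_inv_mul`), and differentiable through
  any continuous chart `e : E → U` along which `b ↦ α((e b)⁻¹ u)` is `C¹` with jointly continuous derivative
  `D(b, u)`, with derivative `∫ h(u) • D(b₀, u) dν(u)` (`hasFDerivAt_integral_mul_inv_mul`; dominated
  differentiation under the integral sign, the integrands living on the compact `e(ball) · tsupport α`).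
* §1 = the sibling file `AutomorphicFormsL2WeightedTranslates` (imported): for a parameter space `S`, a
  continuous `c : S → G(𝔸_K)`, an s-finite `ρ` and a weight `α ∈ L¹(ρ)`, the `L²(μ)`-valued Bochner integral
  `∫ α(s) R(c(s)) [F] dρ(s)` has the strongly measurable representative `y ↦ ∫ α(s) F(c(s)⁻¹ • y) dρ(s)`
  (`coeFn_integral_smul_rightRegular_toLp`).
* §2 (`S = U` a group as in §0 with a left-invariant (Haar) measure `ν`, `ι : U →* G(𝔸_K)` continuous): the
  ORBITAL INTEGRAL `Ψ(x) = ∫ α(u) φ(x ι(u)) dν(u)` is left-`A_G G(K)`-invariant at every point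
  (`orbitalIntegral_mul_left`), reads on the quotient as the representative of §1
  (`orbitalIntegral_inv_apply`, `coeFn_integral_smul_rightRegular_toLp_eq_orbitalIntegral`), and satisfies the
  ORBIT FORMULA `Ψ(x ι(g)) = ∫ α(g⁻¹ u) φ(x ι(u)) dν(u)` for EVERY `x, g` (`orbitalIntegral_mul_hom`, left
  invariance of `ν`; with `α = 1`: averaging over `U` is exactly `ι(U)`-invariant,
  `orbitalIntegral_one_mul_hom`).  The GOOD SET of base points whose orbit function `u ↦ φ(x ι(u))` is locally
  integrable is left-`A_G G(K)`-invariant and right-`ι(U)`-invariant (`orbitFun_mul_left`,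
  `locallyIntegrable_orbit_mul_hom_iff`, `locallyIntegrable_orbitFun_smul_iff`), measurable
  (`measurableSet_locallyIntegrable_orbitFun`) and `μ`-conull for `F ∈ L¹(μ)` strongly measurable
  (`ae_locallyIntegrable_orbitFun`, `ae_locallyIntegrable_orbitFun_inv`: Tonelli over the members of a compact
  exhaustion of `U`); on it `g ↦ Ψ(x ι(g))` is continuous (`continuous_orbitalIntegral_mul_hom`) and
  differentiable through charts (`hasFDerivAt_orbitalIntegral_mul_hom`).

USE (cell hodgecm-mathlib, floor 0, programme P2, socket (D) `holCotFormSpectralProjection`, road (h) step h3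
«the smoothing `R(α) w` of an `L²` class is the class of a function smooth along `U(2,1)`-orbits»): with
`U = U(2,1)` (`BallModel.U21`, Haar), `ι = cmArchSection`, `e = BallForms.expP` and a kernel `α` that is a
smooth function of the matrix entries, §2 gives the everywhere-defined representative of `R(α) w`, its
differentiability along the `expP`-probes at every good base point, and (with `U` a compact subgroup,
`α = 1`) exactly invariant representatives of invariant classes.  Nothing here mentions `U(2,1)`.

## References
* [BorelJacquet1979] A. Borel, H. Jacquet, *Automorphic forms and automorphic representations*, Proc. Sympos.
  Pure Math. 33.1 (1979), §4.6 (the regular representation on `L²(G(K)\G(𝔸))` and its integrated form).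
* [Folland1995] G. B. Folland, *A Course in Abstract Harmonic Analysis* (1995), §2.4 (convolutions, Prop.
  2.39–2.41), §3.1–3.2 (the integrated representation `π(f) = ∫ f(x) π(x) dx`, `f ∈ L¹(G)`).
* [Garrett2018] P. Garrett, *Modern Analysis of Automorphic Forms by Example*, Cambridge Stud. Adv. Math. 173
  (2018), §14.5 (smooth vectors, integral operators; held: corpus `book:garrett2018-…` pp. 170, 304).
* [HarishChandraTAMS1953] Harish-Chandra, Trans. AMS 75 (1953), §9 (well-behaved vectors `∫ f(x) π(x) ψ dx`).
-/

open scoped Topology InnerProductSpace ENNReal NNReal Pointwise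
open NumberField Filter Set Function
open _root_.MeasureTheory _root_.MeasureTheory.Measure

noncomputable section

namespace Literature.NumberTheory.Automorphic

/-! ### 0. Convolution of a compactly supported continuous weight against a locally integrable function -/

section Convolution

variable {U : Type*} [Group U] [TopologicalSpace U] [IsTopologicalGroup U] [MeasurableSpace U] [BorelSpace U]
  [SecondCountableTopology U] [LocallyCompactSpace U] [T2Space U] (ν : Measure U)

/-- **Convolution against a locally integrable function is continuous.** For `h` locally integrable on `U`
and `α` continuous with compact support, `g ↦ ∫ α(g⁻¹ u) h(u) dν(u)` is continuous (dominated convergence on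
a compact neighbourhood `N` of `g₀`: the integrands are supported in `N · tsupport α` and bounded by
`sup |α| · |h|`), the pattern of Folland's Prop. 2.39. [cite: Folland1995, §2.5 (Prop. 2.39)] -/
theorem continuous_integral_mul_inv_mul {α : U → ℂ} (hα : Continuous α)
    (hsupp : HasCompactSupport α) {h : U → ℂ} (hh : LocallyIntegrable h ν) :
    Continuous fun g : U ↦ ∫ u, α (g⁻¹ * u) * h u ∂ν := by
  obtain ⟨M, hM⟩ := hα.bounded_above_of_compact_support hsupp
  refine continuous_iff_continuousAt.2 fun g₀ ↦ ?_
  obtain ⟨N, hN, hNg₀⟩ := exists_compact_mem_nhds g₀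
  set C : Set U := N * tsupport α with hC
  have hCc : IsCompact C := hN.mul hsupp
  have hzero : ∀ g ∈ N, ∀ u ∉ C, α (g⁻¹ * u) = 0 := by
    intro g hg u hu
    by_contra hne
    exact hu ⟨g, hg, g⁻¹ * u, subset_tsupport _ (mem_support.2 hne), mul_inv_cancel_left g u⟩
  refine continuousAt_of_dominated (bound := C.indicator fun u ↦ M * ‖h u‖) ?_ ?_ ?_ ?_
  · exact Eventually.of_forall fun g ↦
      ((hα.comp (continuous_const.inv.mul continuous_id)).aestronglyMeasurable).mul hh.aestronglyMeasurable
  · filter_upwards [hNg₀] with g hg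
    refine Eventually.of_forall fun u ↦ ?_
    by_cases hu : u ∈ C
    · rw [indicator_of_mem hu, norm_mul]
      exact mul_le_mul_of_nonneg_right (hM _) (norm_nonneg _)
    · rw [indicator_of_notMem hu, hzero g hg u hu, zero_mul, norm_zero]
  · rw [integrable_indicator_iff hCc.measurableSet]
    exact ((hh.integrableOn_isCompact hCc).norm.const_mul M)
  · exact Eventually.of_forall fun u ↦
      (((hα.comp (continuous_inv.mul continuous_const)).mul continuous_const).continuousAt)

omit [LocallyCompactSpace U] in
/-- **Differentiation of the convolution along a chart.** Let `e : E → U` be continuous on a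
finite-dimensional real normed space `E`, `α` continuous with compact support, and suppose that on an open
`V ∋ b₀` the functions `b ↦ α((e b)⁻¹ u)` have derivatives `D(b, u)` depending continuously on `(b, u)`.
Then for every locally integrable `h` the map `b ↦ ∫ α((e b)⁻¹ u) h(u) dν(u)` has derivative
`∫ h(u) • D(b₀, u) dν(u)` at `b₀` (differentiation under the integral sign on a compact ball in `V`: the
integrands and their derivatives are supported in the compact `e(ball) · tsupport α`, on which `D` is
bounded); Harish-Chandra's differentiation of `∫ f(x) π(x) ψ dx`. [cite: HarishChandraTAMS1953, §9] [cite: Folland1995, §2.5] -/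
theorem hasFDerivAt_integral_mul_inv_mul {E : Type*} [NormedAddCommGroup E]
    [NormedSpace ℝ E] [ProperSpace E] {α : U → ℂ} (hα : Continuous α) (hsupp : HasCompactSupport α)
    {e : E → U} (he : Continuous e) {V : Set E} (hV : IsOpen V) {b₀ : E} (hb₀ : b₀ ∈ V)
    {D : E × U → (E →L[ℝ] ℂ)} (hD : Continuous D)
    (hderiv : ∀ b ∈ V, ∀ u, HasFDerivAt (fun b' ↦ α ((e b')⁻¹ * u)) (D (b, u)) b)
    {h : U → ℂ} (hh : LocallyIntegrable h ν) :
    HasFDerivAt (fun b ↦ ∫ u, α ((e b)⁻¹ * u) * h u ∂ν) (∫ u, h u • D (b₀, u) ∂ν) b₀ := by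
  obtain ⟨r, hr, hrV⟩ := Metric.isOpen_iff.1 hV b₀ hb₀
  -- work on the half-radius closed ball, compact and inside `V`
  set B : Set E := Metric.closedBall b₀ (r / 2) with hB
  have hBc : IsCompact B := isCompact_closedBall _ _
  have hBV : B ⊆ V := (Metric.closedBall_subset_ball (by linarith)).trans hrV
  have hball : Metric.ball b₀ (r / 2) ⊆ B := Metric.ball_subset_closedBall
  set C : Set U := e '' B * tsupport α with hC
  have hCc : IsCompact C := (hBc.image he).mul hsupp
  have hzero : ∀ b ∈ B, ∀ u ∉ C, α ((e b)⁻¹ * u) = 0 := by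
    intro b hb u hu
    by_contra hne
    exact hu ⟨e b, mem_image_of_mem e hb, (e b)⁻¹ * u, subset_tsupport _ (mem_support.2 hne),
      mul_inv_cancel_left (e b) u⟩
  have hDzero : ∀ b ∈ Metric.ball b₀ (r / 2), ∀ u ∉ C, D (b, u) = 0 := by
    intro b hb u hu
    have hloc : (fun b' ↦ α ((e b')⁻¹ * u)) =ᶠ[𝓝 b] fun _ ↦ (0 : ℂ) := by
      filter_upwards [Metric.isOpen_ball.mem_nhds hb] with b' hb'
      exact hzero b' (hball hb') u hu
    exact (hderiv b (hBV (hball hb)) u).unique ((hasFDerivAt_const (0 : ℂ) b).congr_of_eventuallyEq hloc)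
  obtain ⟨M, hM⟩ := (hBc.prod hCc).exists_bound_of_continuousOn (f := D) hD.continuousOn
  obtain ⟨Mα, hMα⟩ := hα.bounded_above_of_compact_support hsupp
  have hmeasF : ∀ b, AEStronglyMeasurable (fun u ↦ α ((e b)⁻¹ * u) * h u) ν := fun b ↦
    ((hα.comp (continuous_const.inv.mul continuous_id)).aestronglyMeasurable).mul hh.aestronglyMeasurable
  refine hasFDerivAt_integral_of_dominated_of_fderiv_le (F' := fun b u ↦ h u • D (b, u))
    (bound := C.indicator fun u ↦ M * ‖h u‖) (s := Metric.ball b₀ (r / 2))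
    (Metric.ball_mem_nhds b₀ (half_pos hr)) (Eventually.of_forall hmeasF) ?_ ?_ ?_ ?_ ?_
  · -- integrability at `b₀`
    refine Integrable.mono' ((integrable_indicator_iff hCc.measurableSet).2
      ((hh.integrableOn_isCompact hCc).norm.const_mul Mα)) (hmeasF b₀) (Eventually.of_forall fun u ↦ ?_)
    by_cases hu : u ∈ C
    · rw [indicator_of_mem hu, norm_mul]
      exact mul_le_mul_of_nonneg_right (hMα _) (norm_nonneg _)
    · rw [indicator_of_notMem hu, hzero b₀ (Metric.mem_closedBall_self (half_pos hr).le) u hu, zero_mul,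
        norm_zero]
  · exact hh.aestronglyMeasurable.smul ((hD.comp (Continuous.prodMk_right b₀)).aestronglyMeasurable)
  · refine Eventually.of_forall fun u b hb ↦ ?_
    by_cases hu : u ∈ C
    · rw [indicator_of_mem hu, norm_smul, mul_comm]
      exact mul_le_mul_of_nonneg_right (hM (b, u) ⟨hball hb, hu⟩) (norm_nonneg _)
    · simp [indicator_of_notMem hu, hDzero b hb u hu]
  · rw [integrable_indicator_iff hCc.measurableSet]
    exact (hh.integrableOn_isCompact hCc).norm.const_mul M
  · exact Eventually.of_forall fun u b hb ↦ (hderiv b (hBV (hball hb)) u).mul_const (h u)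


end Convolution

namespace AdelicGroupData

/-! ### 2. The representative on the group and its behaviour along `ι`-orbits -/

section OrbitAlgebra

variable {K : Type} [Field K] [NumberField K] (𝒢 : AdelicGroupData K)
  {U : Type*} [Group U] [MeasurableSpace U] (ν : Measure U) {ι : U →* 𝒢.Adelic}

/-- The orbital integral `x ↦ ∫ α(u) φ(x ι(u)) dν(u)` of the left-`A_G G(K)`-invariant `φ = invQuot F` is
left-`A_G G(K)`-invariant (at every point, no null set). [cite: Folland1995, §3.2] -/
theorem orbitalIntegral_mul_left (α : U → ℂ) (F : 𝒢.automorphicQuotient → ℂ) {γ : 𝒢.Adelic}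
    (hγ : γ ∈ 𝒢.quotientSubgroup) (x : 𝒢.Adelic) :
    (∫ u, α u * invQuot 𝒢 F (γ * x * ι u) ∂ν) = ∫ u, α u * invQuot 𝒢 F (x * ι u) ∂ν := by
  congr 1 with u
  rw [mul_assoc, invQuot_mul_left 𝒢 F hγ]

/-- **Dictionary**: the orbital integral at `g⁻¹` is the pointwise representative of
`coeFn_integral_smul_rightRegular_toLp` at `[g]`: `∫ α(u) φ(g⁻¹ ι(u)) dν(u) = ∫ α(u) F(ι(u)⁻¹ • [g]) dν(u)`
(`φ = invQuot F`, D2 dictionary `apply_inv_smul_toAutomorphicQuotient_inv`). [cite: Folland1995, §3.2] -/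
theorem orbitalIntegral_inv_apply (α : U → ℂ) (F : 𝒢.automorphicQuotient → ℂ) (g : 𝒢.Adelic) :
    (∫ u, α u * invQuot 𝒢 F (g⁻¹ * ι u) ∂ν) = ∫ u, α u * F ((ι u)⁻¹ • 𝒢.toAutomorphicQuotient g) ∂ν := by
  congr 1 with u
  rw [← apply_inv_smul_toAutomorphicQuotient_inv F (ι u) g⁻¹, inv_inv]

omit [MeasurableSpace U] in
/-- The orbit function is unchanged under left multiplication of the base point by `A_G G(K)`. [cite: Folland1995, §3.2] -/
theorem orbitFun_mul_left (F : 𝒢.automorphicQuotient → ℂ) {γ : 𝒢.Adelic} (hγ : γ ∈ 𝒢.quotientSubgroup)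
    (x : 𝒢.Adelic) : (fun u ↦ invQuot 𝒢 F (γ * x * ι u)) = fun u ↦ invQuot 𝒢 F (x * ι u) := by
  funext u
  rw [mul_assoc, invQuot_mul_left 𝒢 F hγ]

omit [MeasurableSpace U] in
/-- The orbit function at `g⁻¹` read on the quotient: `φ(g⁻¹ ι(u)) = F(ι(u)⁻¹ • [g])`. [cite: Folland1995, §3.2] -/
theorem orbitFun_inv_apply (F : 𝒢.automorphicQuotient → ℂ) (g : 𝒢.Adelic) :
    (fun u ↦ invQuot 𝒢 F (g⁻¹ * ι u)) = fun u ↦ F ((ι u)⁻¹ • 𝒢.toAutomorphicQuotient g) := by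
  funext u
  rw [← apply_inv_smul_toAutomorphicQuotient_inv F (ι u) g⁻¹, inv_inv]

end OrbitAlgebra

section Orbit

variable {K : Type} [Field K] [NumberField K] (𝒢 : AdelicGroupData K)
  (μ : Measure 𝒢.automorphicQuotient) [𝒢.IsAutomorphicMeasure μ]
  {U : Type*} [Group U] [TopologicalSpace U] [IsTopologicalGroup U] [MeasurableSpace U] [BorelSpace U]
  [SecondCountableTopology U]
  (ν : Measure U) [ν.IsHaarMeasure] {ι : U →* 𝒢.Adelic}
-- continuity / differentiability along orbits use, in addition, `[LocallyCompactSpace U] [T2Space U]`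

omit [𝒢.IsAutomorphicMeasure μ] [SecondCountableTopology U] in
/-- **Orbit formula (left invariance of Haar).** Along the `ι`-orbit the orbital integral is a
convolution: `∫ α(u) φ(x ι(g) ι(u)) dν(u) = ∫ α(g⁻¹ u) φ(x ι(u)) dν(u)` for EVERY `x` and `g` (substitution
`u ↦ g⁻¹ u`, `ν` left-invariant; no unimodularity). [cite: Folland1995, §3.2] -/
theorem orbitalIntegral_mul_hom (α : U → ℂ) (F : 𝒢.automorphicQuotient → ℂ) (x : 𝒢.Adelic) (g : U) :
    (∫ u, α u * invQuot 𝒢 F (x * ι g * ι u) ∂ν) = ∫ u, α (g⁻¹ * u) * invQuot 𝒢 F (x * ι u) ∂ν := by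
  have h := integral_mul_left_eq_self (μ := ν) (fun u ↦ α (g⁻¹ * u) * invQuot 𝒢 F (x * ι u)) g
  simp only [inv_mul_cancel_left] at h
  rw [← h]
  congr 1 with u
  rw [map_mul, mul_assoc]

omit [𝒢.IsAutomorphicMeasure μ] [SecondCountableTopology U] in
/-- The orbit function `u ↦ φ(x ι(g) ι(u))` of the translated base point is the left translate
`u ↦ φ(x ι(g u))` of the orbit function at `x`; local integrability is preserved (`ν` left-invariant,
`u ↦ g u` a measure-preserving homeomorphism). [cite: Folland1995, §3.2] -/
theorem locallyIntegrable_orbit_mul_hom_iff (F : 𝒢.automorphicQuotient → ℂ) (x : 𝒢.Adelic) (g : U) :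
    LocallyIntegrable (fun u ↦ invQuot 𝒢 F (x * ι g * ι u)) ν ↔
      LocallyIntegrable (fun u ↦ invQuot 𝒢 F (x * ι u)) ν := by
  have h := locallyIntegrable_map_homeomorph (Homeomorph.mulLeft g)
    (f := fun u ↦ invQuot 𝒢 F (x * ι u)) (μ := ν)
  rw [Homeomorph.coe_mulLeft, map_mul_left_eq_self] at h
  rw [h]
  exact Iff.of_eq (by congr 1; funext u; simp only [comp_apply, map_mul, mul_assoc])

/-! #### The good set: base points with locally integrable orbit function -/

/-- **Almost every orbit function is locally integrable.** For `F ∈ L¹(μ)` strongly measurable and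
`ι : U →* G(𝔸_K)` continuous, for `μ`-a.e. `y` the orbit function `u ↦ F(ι(u)⁻¹ • y)` is locally integrable
for the Haar measure `ν` (Tonelli over `K × (G(𝔸_K) ⧸ A_G G(K))` for the members `K` of a compact exhaustion
of `U`, and invariance of `μ`: `∫∫_K |F(ι(u)⁻¹ • y)| dν dμ = ν(K) ‖F‖₁`). [cite: Folland1995, §3.2] -/
theorem ae_locallyIntegrable_orbitFun [LocallyCompactSpace U] (hι : Continuous ι)
    {F : 𝒢.automorphicQuotient → ℂ} (hFm : StronglyMeasurable F) (hFi : Integrable F μ) :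
    ∀ᵐ y ∂μ, LocallyIntegrable (fun u ↦ F ((ι u)⁻¹ • y)) ν := by
  set Kn : CompactExhaustion U := default
  have hT : Measurable fun p : U × 𝒢.automorphicQuotient ↦ (ι p.1)⁻¹ • p.2 :=
    𝒢.measurable_param_smul hι.inv
  have hG : Measurable fun p : 𝒢.automorphicQuotient × U ↦ ‖F ((ι p.2)⁻¹ • p.1)‖ₑ :=
    (hFm.measurable.comp (hT.comp measurable_swap)).enorm
  have hfin : ∀ n : ℕ, ∀ᵐ y ∂μ, (∫⁻ u in Kn n, ‖F ((ι u)⁻¹ • y)‖ₑ ∂ν) < ∞ := by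
    intro n
    have hmeas : Measurable fun y ↦ ∫⁻ u in Kn n, ‖F ((ι u)⁻¹ • y)‖ₑ ∂ν :=
      hG.lintegral_prod_right'
    refine ae_lt_top hmeas ?_
    rw [lintegral_lintegral_swap (f := fun y u ↦ ‖F ((ι u)⁻¹ • y)‖ₑ) hG.aemeasurable]
    have hinner : ∀ u, ∫⁻ y, ‖F ((ι u)⁻¹ • y)‖ₑ ∂μ = ∫⁻ y, ‖F y‖ₑ ∂μ := fun u ↦
      (measurePreserving_smul (ι u)⁻¹ μ).lintegral_comp hFm.measurable.enorm
    simp_rw [hinner, lintegral_const]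
    rw [Measure.restrict_apply_univ]
    exact ENNReal.mul_ne_top hFi.2.ne ((Kn.isCompact n).measure_lt_top).ne
  rw [← ae_all_iff] at hfin
  filter_upwards [hfin] with y hy
  rw [locallyIntegrable_iff]
  intro k hk
  obtain ⟨n, hn⟩ := Kn.exists_superset_of_isCompact hk
  refine IntegrableOn.mono_set ⟨?_, hy n⟩ hn
  exact (hFm.comp_measurable (hι.inv.smul continuous_const).measurable).aestronglyMeasurable

/-- **The good set is measurable.** For `F` strongly measurable, the set of `y` whose orbit function
`u ↦ F(ι(u)⁻¹ • y)` is locally integrable is a measurable subset of the quotient: it is the intersection over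
a compact exhaustion `(K_n)` of `U` of the sets `{y | ∫⁻_{K_n} ‖F(ι(u)⁻¹ • y)‖ dν(u) < ∞}` (Tonelli
measurability). [cite: Folland1995, §3.2] -/
theorem measurableSet_locallyIntegrable_orbitFun [LocallyCompactSpace U] (hι : Continuous ι)
    {F : 𝒢.automorphicQuotient → ℂ} (hFm : StronglyMeasurable F) :
    MeasurableSet {y : 𝒢.automorphicQuotient | LocallyIntegrable (fun u ↦ F ((ι u)⁻¹ • y)) ν} := by
  set Kn : CompactExhaustion U := default
  have hT : Measurable fun p : U × 𝒢.automorphicQuotient ↦ (ι p.1)⁻¹ • p.2 :=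
    𝒢.measurable_param_smul hι.inv
  have hG : Measurable fun p : 𝒢.automorphicQuotient × U ↦ ‖F ((ι p.2)⁻¹ • p.1)‖ₑ :=
    (hFm.measurable.comp (hT.comp measurable_swap)).enorm
  have hmeas : ∀ n : ℕ, Measurable fun y ↦ ∫⁻ u in Kn n, ‖F ((ι u)⁻¹ • y)‖ₑ ∂ν := fun n ↦
    hG.lintegral_prod_right'
  have hsm : ∀ y, AEStronglyMeasurable (fun u ↦ F ((ι u)⁻¹ • y)) ν := fun y ↦
    (hFm.comp_measurable (hι.inv.smul continuous_const).measurable).aestronglyMeasurable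
  have heq : {y : 𝒢.automorphicQuotient | LocallyIntegrable (fun u ↦ F ((ι u)⁻¹ • y)) ν} =
      ⋂ n : ℕ, {y | (∫⁻ u in Kn n, ‖F ((ι u)⁻¹ • y)‖ₑ ∂ν) < ∞} := by
    ext y
    simp only [mem_setOf_eq, mem_iInter]
    constructor
    · intro h n
      exact (h.integrableOn_isCompact (Kn.isCompact n)).2
    · intro h
      rw [locallyIntegrable_iff]
      intro k hk
      obtain ⟨n, hn⟩ := Kn.exists_superset_of_isCompact hk
      exact IntegrableOn.mono_set ⟨(hsm y).restrict, h n⟩ hn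
  rw [heq]
  exact MeasurableSet.iInter fun n ↦ measurableSet_lt (hmeas n) measurable_const

omit [𝒢.IsAutomorphicMeasure μ] [SecondCountableTopology U] in
/-- **The good set is `ι(U)`-invariant**: the orbit function of `ι(g) • y` is the left translate by `g⁻¹` of
the orbit function of `y`, so one is locally integrable iff the other is (`ν` left-invariant). [cite: Folland1995, §3.2] -/
theorem locallyIntegrable_orbitFun_smul_iff (F : 𝒢.automorphicQuotient → ℂ) (y : 𝒢.automorphicQuotient)
    (g : U) :
    LocallyIntegrable (fun u ↦ F ((ι u)⁻¹ • (ι g • y))) ν ↔ LocallyIntegrable (fun u ↦ F ((ι u)⁻¹ • y)) ν := by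
  have h := locallyIntegrable_map_homeomorph (Homeomorph.mulLeft g⁻¹)
    (f := fun u ↦ F ((ι u)⁻¹ • y)) (μ := ν)
  rw [Homeomorph.coe_mulLeft, map_mul_left_eq_self] at h
  rw [h]
  refine Iff.of_eq ?_
  congr 1
  funext u
  simp only [comp_apply, map_mul, map_inv, mul_inv_rev, inv_inv, mul_smul]

/-! #### The orbital integral `Ψ(x) = ∫ α(u) φ(x ι(u)) dν(u)` along orbits, and its `L²` class -/

omit [𝒢.IsAutomorphicMeasure μ] [SecondCountableTopology U] in
/-- **Averaging over `U` with the constant weight is exactly `ι(U)`-invariant** (the case `α = 1` of the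
orbit formula; used with `U` a compact subgroup and `ν` its Haar probability measure to produce EXACTLY
invariant representatives of invariant classes). [cite: Folland1995, §3.2] -/
theorem orbitalIntegral_one_mul_hom (F : 𝒢.automorphicQuotient → ℂ) (x : 𝒢.Adelic) (g : U) :
    (∫ u, invQuot 𝒢 F (x * ι g * ι u) ∂ν) = ∫ u, invQuot 𝒢 F (x * ι u) ∂ν := by
  have h := 𝒢.orbitalIntegral_mul_hom ν (fun _ ↦ (1 : ℂ)) F x g (ι := ι)
  simpa only [one_mul] using h

omit [𝒢.IsAutomorphicMeasure μ] in
/-- **The orbital integral is continuous along the `ι`-orbit of every good base point**: if the orbit function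
`u ↦ φ(x ι(u))` (`φ = invQuot F`) is locally integrable, then `g ↦ Ψ(x ι(g))`, `Ψ(x) = ∫ α(u) φ(x ι(u)) dν(u)`,
is continuous on `U` for `α` continuous with compact support (orbit formula + continuity of the
convolution). [cite: Folland1995, §3.2] -/
theorem continuous_orbitalIntegral_mul_hom [LocallyCompactSpace U] [T2Space U] {α : U → ℂ}
    (hα : Continuous α) (hsupp : HasCompactSupport α) (F : 𝒢.automorphicQuotient → ℂ) {x : 𝒢.Adelic}
    (hx : LocallyIntegrable (fun u ↦ invQuot 𝒢 F (x * ι u)) ν) :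
    Continuous fun g : U ↦ ∫ u, α u * invQuot 𝒢 F (x * ι g * ι u) ∂ν := by
  simp_rw [𝒢.orbitalIntegral_mul_hom ν α F x]
  exact continuous_integral_mul_inv_mul ν hα hsupp hx

omit [𝒢.IsAutomorphicMeasure μ] in
/-- **The orbital integral is differentiable along the `ι`-orbit of every good base point, through any
chart `e : E → U` along which the weight is `C¹`**: under the hypotheses of `hasFDerivAt_integral_mul_inv_mul`
on `α`, `e`, `D`, if the orbit function `u ↦ φ(x ι(u))` is locally integrable then
`b ↦ Ψ(x ι(e b))` has derivative `∫ φ(x ι(u)) • D(b₀, u) dν(u)` at `b₀`. [cite: Folland1995, §3.2] -/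
theorem hasFDerivAt_orbitalIntegral_mul_hom [LocallyCompactSpace U] [T2Space U] {E : Type*}
    [NormedAddCommGroup E] [NormedSpace ℝ E] [ProperSpace E] {α : U → ℂ} (hα : Continuous α)
    (hsupp : HasCompactSupport α) {e : E → U} (he : Continuous e) {V : Set E} (hV : IsOpen V) {b₀ : E}
    (hb₀ : b₀ ∈ V) {D : E × U → (E →L[ℝ] ℂ)} (hD : Continuous D)
    (hderiv : ∀ b ∈ V, ∀ u, HasFDerivAt (fun b' ↦ α ((e b')⁻¹ * u)) (D (b, u)) b)
    (F : 𝒢.automorphicQuotient → ℂ) {x : 𝒢.Adelic} (hx : LocallyIntegrable (fun u ↦ invQuot 𝒢 F (x * ι u)) ν) :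
    HasFDerivAt (fun b ↦ ∫ u, α u * invQuot 𝒢 F (x * ι (e b) * ι u) ∂ν)
      (∫ u, invQuot 𝒢 F (x * ι u) • D (b₀, u) ∂ν) b₀ := by
  simp_rw [𝒢.orbitalIntegral_mul_hom ν α F x]
  exact hasFDerivAt_integral_mul_inv_mul ν hα hsupp he hV hb₀ hD hderiv hx

/-- **Almost every base point is good, group form**: for `F ∈ L¹(μ)` strongly measurable and `ι` continuous,
for `μ`-a.e. `y` and EVERY `g` with `[g] = y`, the orbit function `u ↦ φ(g⁻¹ ι(u))` is locally integrable
(`ae_locallyIntegrable_orbitFun` read through the dictionary `orbitFun_inv_apply`). [cite: Folland1995, §3.2] -/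
theorem ae_locallyIntegrable_orbitFun_inv [LocallyCompactSpace U] (hι : Continuous ι)
    {F : 𝒢.automorphicQuotient → ℂ} (hFm : StronglyMeasurable F) (hFi : Integrable F μ) :
    ∀ᵐ y ∂μ, ∀ g : 𝒢.Adelic, 𝒢.toAutomorphicQuotient g = y →
      LocallyIntegrable (fun u ↦ invQuot 𝒢 F (g⁻¹ * ι u)) ν := by
  filter_upwards [𝒢.ae_locallyIntegrable_orbitFun μ ν hι hFm hFi] with y hy g hg
  rw [𝒢.orbitFun_inv_apply, hg]
  exact hy

/-- **The `L²` class of the orbital integral.** For `α` continuous with compact support, `ι` continuous and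
`F ∈ ℒ²(μ)`, the Bochner integral `∫ α(u) R(ι(u)) [F] dν(u)` in `L²(μ)` is represented, at `μ`-a.e. `y` and for
every `g` with `[g] = y`, by the value `Ψ(g⁻¹)` of the orbital integral `Ψ(x) = ∫ α(u) φ(x ι(u)) dν(u)`,
`φ = invQuot F` — i.e. `Ψ` is the left-invariant function on `G(𝔸_K)` whose reading on the quotient is the
class `∫ α(u) R(ι(u)) [F] dν(u)` (Borel–Jacquet's `π(α)`). [cite: BorelJacquetCorvallis1979, §4.6] [cite: Folland1995, §3.2] -/
theorem coeFn_integral_smul_rightRegular_toLp_eq_orbitalIntegral [LocallyCompactSpace U] (hι : Continuous ι) {α : U → ℂ}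
    (hα : Continuous α) (hsupp : HasCompactSupport α) {F : 𝒢.automorphicQuotient → ℂ} (hF : MemLp F 2 μ) :
    ∀ᵐ y ∂μ, ∀ g : 𝒢.Adelic, 𝒢.toAutomorphicQuotient g = y →
      ((∫ u, α u • 𝒢.rightRegular μ (ι u) (hF.toLp F) ∂ν : 𝒢.L2 μ) : 𝒢.automorphicQuotient → ℂ) y =
        ∫ u, α u * invQuot 𝒢 F (g⁻¹ * ι u) ∂ν := by
  filter_upwards [𝒢.coeFn_integral_smul_rightRegular_toLp μ hι ν (hα.integrable_of_hasCompactSupport hsupp)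
    hF] with y hy g hg
  rw [hy, 𝒢.orbitalIntegral_inv_apply, hg]

end Orbit

end AdelicGroupData

end Literature.NumberTheory.Automorphic
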